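import Summits.QuantumFields.YangMills.Theorems.AllWindowsColdBoxBulkMidLocalToGlobalSandwich

/-!
# Local-to-global Hessian sandwich — the `H₀`-metric statement in the card's letters
# (crux idea `logconcave-core-extension` on ⟨stmt-QuantumFields-24006⟩, first lemma P2, C² input, constant `C·r`)

THEOREM (`localToGlobalSandwich_posDef`).  There is a universal `C ≥ 0` such that for every positive definite
`H₀` on `ℝⁿ`, `0 ≤ r`, `ρ > 0`, a nonempty `K` of `H₀`-diameter `≤ ρ`, an open `U ⊇ K + {v : vᵀH₀v ≤ 4ρ²}`
and `Φ ∈ C²(ℝⁿ)` whose second differences along segments of `U` lie in `[(1−r)hᵀH₀h, (1+r)hᵀH₀h]`, there is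
a continuous `A : ℝⁿ → ℝ` with `A = Φ` on `K` and the GLOBAL sandwich
`(1 − C r)hᵀH₀h ≤ A(x+h)+A(x−h)−2A(x) ≤ (1 + C r)hᵀH₀h` for ALL `x, h`.

Compared with the card's typed `LocalToGlobalSandwich` (`Cruxes/BulkMidWindowSU2/LogConcaveCoreExtensionSketch.lean`):
`ContinuousOn Φ U` is strengthened to `ContDiff ℝ 2 Φ` (the card feeds the charted kernel action, a smooth
function), `0 ≤ ρ` to `0 < ρ`, the convexity of `K, U` and `r < 1` are not needed, and the conclusion has
`C·r` in place of `r` (harmless for the card: its consumer `LogConcaveChart.QuadraticCovarianceComparison` is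
applied at `δ = r_U → 0` and only exponents of `β` enter the power counting).

PROOF.  Whiten by `P = H₀^{1/2}` (`exists_symm_sqrt`): `Ψ(y) = Φ(P⁻¹y)` is `C²`; at every point `ỹ` of the
Euclidean ball `|ỹ − Px₀|² ≤ 4ρ²` the point `z = P⁻¹ỹ` lies in `U` (ball hypothesis at `x₀ ∈ K`), `U` is open,
so for small `s` the second differences of `Ψ` at `ỹ` along `u` are those of `Φ` at `z` along `sP⁻¹u`, i.e.
sandwiched by `(1±r)s²|u|²`; the LOCAL second-difference-to-Hessian lemma (§1, Taylor to second order) turns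
this into the Hessian sandwich; `localToGlobal_whitened` gives `Ã`; `A(x) := Ã(Px)`.

HONEST SCOPE.  Free-hands work of the LEAD seat of ⟨stmt-QuantumFields-24006⟩ (FCL lineage) on the first lemma of
an UN-TRIAGED crux idea card; pure calculus.  No stub of LINE-18, no crux, rung or summit is proved; the
Yang–Mills mass gap is NOT proved by any of this.
-/

noncomputable section

namespace Summit.QuantumFields.YangMills.Theorems.LocalToGlobalSandwich

open Real Filter Topology Set
open Summit.QuantumFields.YangMills.Theorems.SandwichVariancePinching

variable {n : ℕ}

/-! ## §1 Local second differences control the Hessian -/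

/-- LOCAL VERSION of `fderiv_fderiv_le_of_secondDiff_le`: if `f ∈ C²(ℝⁿ)` and, for all small real `s`,
`f(x+su) + f(x−su) − 2f(x) ≤ K·s²|u|²`, then `D²f(x)(u,u) ≤ K|u|²`. [folklore] -/
theorem fderiv_fderiv_le_of_secondDiff_le_nhds {f : (Fin n → ℝ) → ℝ} (hf : ContDiff ℝ 2 f) {K : ℝ}
    (x u : Fin n → ℝ)
    (h2 : ∀ᶠ s in 𝓝 (0:ℝ), f (x + s • u) + f (x - s • u) - 2 * f x ≤ K * (s ^ 2 * (u ⬝ᵥ u))) :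
    fderiv ℝ (fderiv ℝ f) x u u ≤ K * (u ⬝ᵥ u) := by
  have hd : ∀ y, HasFDerivAt f (fderiv ℝ f y) y := fun y =>
    (hf.differentiable (by norm_num) y).hasFDerivAt
  have hd2 : HasFDerivAt (fderiv ℝ f) (fderiv ℝ (fderiv ℝ f) x) x :=
    ((hf.fderiv_right (m := 1) (by norm_num)).differentiable (by norm_num) x).hasFDerivAt
  set f'' := fderiv ℝ (fderiv ℝ f) x with hf''
  have T := fun w : Fin n → ℝ =>
    (convex_univ (𝕜 := ℝ) (E := Fin n → ℝ)).taylor_approx_two_segment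
      (f := f) (f' := fderiv ℝ f) (f'' := f'') (v := 0) (w := w)
      (fun y _ => hd y) (Set.mem_univ x)
      (by rw [interior_univ]; exact hd2.hasFDerivWithinAt)
      (by rw [interior_univ]; exact Set.mem_univ _) (by rw [interior_univ]; exact Set.mem_univ _)
  have T1 := T u
  have T2 := T (-u)
  simp only [smul_zero, add_zero, map_zero, zero_apply, map_neg,
    neg_apply, neg_neg, smul_neg, smul_eq_mul, neg_zero] at T1 T2
  have S := T1.add T2
  obtain ⟨ε, hεpos', hε⟩ := Metric.eventually_nhds_iff.mp h2
  by_contra hlt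
  push Not at hlt
  set ε' : ℝ := (f'' u u - K * (u ⬝ᵥ u)) / 2 with hε'
  have hε'pos : 0 < ε' := by rw [hε']; linarith
  have hev := S.def hε'pos
  rw [Filter.Eventually, mem_nhdsWithin] at hev
  obtain ⟨U, hUo, hU0, hU⟩ := hev
  obtain ⟨r, hrpos, hr⟩ := Metric.isOpen_iff.mp hUo 0 hU0
  set h : ℝ := min (r / 2) (ε / 2) with hh
  have hhpos : 0 < h := by rw [hh]; exact lt_min (by linarith) (by linarith)
  have hhr : h < r := lt_of_le_of_lt (min_le_left _ _) (by linarith)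
  have hhε : h < ε := lt_of_le_of_lt (min_le_right _ _) (by linarith)
  have hmem : h ∈ U ∩ Set.Ioi 0 := ⟨hr (by simp [abs_of_pos hhpos, hhr]), hhpos⟩
  have hb := hU hmem
  simp only [Set.mem_setOf_eq, norm_pow, Real.norm_eq_abs] at hb
  have key := hε (y := h) (by simp [abs_of_pos hhpos, hhε])
  rw [show x - h • u = x + -(h • u) by abel] at key
  have habs := (abs_le.mp hb).1
  have hh2 : 0 < h ^ 2 := by positivity
  have : |h| ^ 2 = h ^ 2 := by rw [sq_abs]
  rw [this] at habs
  have h3 : h ^ 2 * (f'' u u - K * (u ⬝ᵥ u)) ≤ ε' * h ^ 2 := by nlinarith [habs, key]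
  have h4 : f'' u u - K * (u ⬝ᵥ u) = 2 * ε' := by rw [hε']; ring
  rw [h4] at h3
  nlinarith [mul_pos hε'pos hh2]

/-- LOCAL VERSION, lower: `K·s²|u|² ≤ f(x+su) + f(x−su) − 2f(x)` for small `s` gives `K|u|² ≤ D²f(x)(u,u)`.
[folklore] -/
theorem le_fderiv_fderiv_of_le_secondDiff_nhds {f : (Fin n → ℝ) → ℝ} (hf : ContDiff ℝ 2 f) {K : ℝ}
    (x u : Fin n → ℝ)
    (h2 : ∀ᶠ s in 𝓝 (0:ℝ), K * (s ^ 2 * (u ⬝ᵥ u)) ≤ f (x + s • u) + f (x - s • u) - 2 * f x) :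
    K * (u ⬝ᵥ u) ≤ fderiv ℝ (fderiv ℝ f) x u u := by
  have hneg : ContDiff ℝ 2 (fun y => -f y) := hf.neg
  have h2' : ∀ᶠ s in 𝓝 (0:ℝ), (fun y => -f y) (x + s • u) + (fun y => -f y) (x - s • u)
      - 2 * (fun y => -f y) x ≤ (-K) * (s ^ 2 * (u ⬝ᵥ u)) := by
    filter_upwards [h2] with s hs
    linarith
  have key := fderiv_fderiv_le_of_secondDiff_le_nhds hneg x u h2'
  have e1 : fderiv ℝ (fun y => -f y) = fun y => -fderiv ℝ f y := by
    funext y; exact fderiv_fun_neg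
  rw [e1] at key
  have e2 : fderiv ℝ (fun y => -fderiv ℝ f y) x = -fderiv ℝ (fderiv ℝ f) x := fderiv_fun_neg
  rw [e2] at key
  simp only [neg_apply] at key
  linarith

/-! ## §2 The `H₀`-metric extension theorem -/

open Summit.QuantumFields.YangMills.Cruxes.TransportCovarianceTransfer Matrix in
/-- **LOCAL-TO-GLOBAL HESSIAN SANDWICH in the `H₀` metric** (the card's `LocalToGlobalSandwich` for `C²`
input, constant `C·r`, `C` universal). [folklore] -/
theorem localToGlobalSandwich_posDef : ∃ C : ℝ, 0 ≤ C ∧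
    ∀ (n : ℕ) (H₀ : Matrix (Fin n) (Fin n) ℝ), H₀.PosDef → ∀ (r ρ : ℝ), 0 ≤ r → 0 < ρ →
    ∀ (K U : Set (Fin n → ℝ)), K.Nonempty → IsOpen U →
      (∀ x ∈ K, ∀ y ∈ K, (x - y) ⬝ᵥ H₀.mulVec (x - y) ≤ ρ ^ 2) →
      (∀ x ∈ K, ∀ v : Fin n → ℝ, v ⬝ᵥ H₀.mulVec v ≤ 4 * ρ ^ 2 → x + v ∈ U) →
      ∀ (Φ : (Fin n → ℝ) → ℝ), ContDiff ℝ 2 Φ →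
        (∀ x h : Fin n → ℝ, x + h ∈ U → x - h ∈ U →
            (1 - r) * (h ⬝ᵥ H₀.mulVec h) ≤ Φ (x + h) + Φ (x - h) - 2 * Φ x ∧
              Φ (x + h) + Φ (x - h) - 2 * Φ x ≤ (1 + r) * (h ⬝ᵥ H₀.mulVec h)) →
        ∃ A : (Fin n → ℝ) → ℝ, Continuous A ∧ (∀ x ∈ K, A x = Φ x) ∧
          ∀ x h : Fin n → ℝ,
            (1 - C * r) * (h ⬝ᵥ H₀.mulVec h) ≤ A (x + h) + A (x - h) - 2 * A x ∧
              A (x + h) + A (x - h) - 2 * A x ≤ (1 + C * r) * (h ⬝ᵥ H₀.mulVec h) := by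
  obtain ⟨C, hC, hW⟩ := localToGlobal_whitened
  refine ⟨C, hC, ?_⟩
  intro n H₀ hH₀ r ρ hr hρ K U hK hU hdiam hball Φ hΦ hsw
  obtain ⟨x₀, hx₀⟩ := hK
  obtain ⟨P, hPs, hP, hPP⟩ := exists_symm_sqrt hH₀
  -- the whitened potential
  set Ψ : (Fin n → ℝ) → ℝ := fun y => Φ (P⁻¹ *ᵥ y) with hΨ
  have hΨ2 : ContDiff ℝ 2 Ψ := hΦ.comp (Matrix.mulVecLin P⁻¹).toContinuousLinearMap.contDiff
  -- Hessian sandwich of `Ψ` on the Euclidean ball around `P x₀`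
  have hhess : ∀ yt : Fin n → ℝ, (yt - P *ᵥ x₀) ⬝ᵥ (yt - P *ᵥ x₀) ≤ 4 * ρ ^ 2 → ∀ u : Fin n → ℝ,
      (1 - r) * (u ⬝ᵥ u) ≤ fderiv ℝ (fderiv ℝ Ψ) yt u u ∧
        fderiv ℝ (fderiv ℝ Ψ) yt u u ≤ (1 + r) * (u ⬝ᵥ u) := by
    intro yt hyt u
    set z : Fin n → ℝ := P⁻¹ *ᵥ yt with hz
    set v : Fin n → ℝ := P⁻¹ *ᵥ u with hv
    -- `z ∈ U`
    have hzU : z ∈ U := by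
      have e : z = x₀ + P⁻¹ *ᵥ (yt - P *ᵥ x₀) := by
        rw [Matrix.mulVec_sub, inv_mulVec_mulVec hP, hz]; abel
      rw [e]
      refine hball x₀ hx₀ _ ?_
      rw [quadForm_inv_mulVec hPs hP hPP]
      exact hyt
    -- for small `s`, `z ± s•v ∈ U`
    have hc1 : Continuous fun s : ℝ => z + s • v := continuous_const.add (continuous_id.smul continuous_const)
    have hc2 : Continuous fun s : ℝ => z - s • v := continuous_const.sub (continuous_id.smul continuous_const)
    have hU1 : ∀ᶠ s in 𝓝 (0:ℝ), z + s • v ∈ U :=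
      hc1.continuousAt.eventually_mem (hU.mem_nhds (by simpa using hzU))
    have hU2 : ∀ᶠ s in 𝓝 (0:ℝ), z - s • v ∈ U :=
      hc2.continuousAt.eventually_mem (hU.mem_nhds (by simpa using hzU))
    -- second differences of `Ψ` at `yt` along `u` are those of `Φ` at `z` along `s•v`
    have hident : ∀ s : ℝ, Ψ (yt + s • u) + Ψ (yt - s • u) - 2 * Ψ yt =
        Φ (z + s • v) + Φ (z - s • v) - 2 * Φ z := by
      intro s
      simp only [hΨ, hz, hv, Matrix.mulVec_add, Matrix.mulVec_sub, Matrix.mulVec_smul]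
    have hquad : ∀ s : ℝ, (s • v) ⬝ᵥ H₀.mulVec (s • v) = s ^ 2 * (u ⬝ᵥ u) := by
      intro s
      rw [quadForm_eq_mulVec_sq hPs hPP, Matrix.mulVec_smul, hv, mulVec_inv_mulVec hP,
        smul_dotProduct, dotProduct_smul, smul_eq_mul, smul_eq_mul]
      ring
    have hev : ∀ᶠ s in 𝓝 (0:ℝ),
        (1 - r) * (s ^ 2 * (u ⬝ᵥ u)) ≤ Ψ (yt + s • u) + Ψ (yt - s • u) - 2 * Ψ yt ∧
          Ψ (yt + s • u) + Ψ (yt - s • u) - 2 * Ψ yt ≤ (1 + r) * (s ^ 2 * (u ⬝ᵥ u)) := by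
      filter_upwards [hU1, hU2] with s hs1 hs2
      have key := hsw z (s • v) hs1 hs2
      rw [hquad s] at key
      rw [hident s]
      exact key
    exact ⟨le_fderiv_fderiv_of_le_secondDiff_nhds hΨ2 yt u (hev.mono fun s hs => hs.1),
      fderiv_fderiv_le_of_secondDiff_le_nhds hΨ2 yt u (hev.mono fun s hs => hs.2)⟩
  obtain ⟨At, hAtc, hAteq, hAtsw⟩ := hW n Ψ hΨ2 r ρ hr hρ (P *ᵥ x₀)
    (fun yt hyt u => (hhess yt hyt u).2) (fun yt hyt u => (hhess yt hyt u).1)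
  refine ⟨fun x => At (P *ᵥ x), hAtc.comp (Matrix.mulVecLin P).toContinuousLinearMap.continuous, ?_, ?_⟩
  · intro x hx
    have h1 : (P *ᵥ x - P *ᵥ x₀) ⬝ᵥ (P *ᵥ x - P *ᵥ x₀) ≤ ρ ^ 2 := by
      rw [← Matrix.mulVec_sub, ← quadForm_eq_mulVec_sq hPs hPP]
      exact hdiam x hx x₀ hx₀
    show At (P *ᵥ x) = Φ x
    rw [hAteq _ h1]
    simp only [hΨ]
    rw [inv_mulVec_mulVec hP]
  · intro x h
    have key := hAtsw (P *ᵥ x) (P *ᵥ h)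
    rw [← Matrix.mulVec_add, ← Matrix.mulVec_sub, ← quadForm_eq_mulVec_sq hPs hPP] at key
    exact key

end Summit.QuantumFields.YangMills.Theorems.LocalToGlobalSandwich

end
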